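import Summits.ValiantsHypothesis.ValiantsHypothesis.Theorems.SymPencilPerFourSixDimDetecting
import Summits.ValiantsHypothesis.ValiantsHypothesis.Theorems.SymPencilPerFourSixDimPropPair
import Summits.ValiantsHypothesis.ValiantsHypothesis.Theorems.SymPencilPerFourSixDimZeroCellSix
import Summits.ValiantsHypothesis.ValiantsHypothesis.Theorems.SymPencilPerFourToricFive
import Summits.ValiantsHypothesis.ValiantsHypothesis.Theorems.SymPencilSdcPerFourInnerRankH88
import Mathlib.LinearAlgebra.Dual.Lemmas

/-!
# Route `SymPencil` — `H106` unconditionally: no `6`-dimensional singular subspace of `per_4`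
# carries a joint family of `< 6` squares; hence size `≤ 25` forces size `25` with a Lagrangian
# one-row kernel (`--supports` stmt-ValiantsHypothesis-5674 `SdcSuperquadratic`; the `(10,6,4)`
# cell of `Cruxes/SdcSuperquadratic/NEXT-RUNG-25.md`, crux workfile `TORIC-SIX.md`)

**Theorem** (`noJointFamily_six`).  Over a field of characteristic `0`, no `6`-dimensional
`V ⊆ Sing Z(per_4)` carries a per-base-point and a per-direction family of `< 6` squares of the
`s²`-coefficient of `per_4 (u + s y)` (in particular no joint/bilinear family — `H106`).

Proof = val-width-5674-p2's Task-T1 dispatcher run at dimension `6` exactly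
(`finrank_map_row_le_two_six`): a row of rank `4` or a generic rank-`3` row gives `dim ≤ 4`
(`SymPencilPerFourHessianRowControl` / `…ColControl`); a rank-`3` row with a proportional pair
gives `dim ≤ 5` (`SymPencilPerFourSixDimPropPair`); a rank-`3` row with a zero cell puts `V` in
two rows or a cross (`SymPencilPerFourSixDimZeroCellSix`), killed by the bricks
`SymPencilPerFourSixDimDetecting.false_of_detecting_rows_six` / `SymPencilPerFourSixDimCross`;
so all rows — and by transposition all columns — have rank `≤ 2`, and then
`SymPencilPerFourToricFive.finrank_le_five_of_ranks_le_two` (H3 alone) gives `dim ≤ 5`.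

**Corollary** (`eq_twentyFive_and_oneRowKernel`): with val-width-5674-p2 g2's `H88`
(`SymPencilSdcPerFourInnerRankH88.not_joint_eight_squares`) both hypotheses of
`SymPencilSdcPerFourTwentySixReduction.eq_twentyFive_and_oneRowKernel_of_le_twentyFive` are now
theorems: **every symmetric affine determinantal representation of `per_4` of size `m ≤ 25`
(characteristic `0`) has `m = 25`, Lagrangian kernel rows and a `4`-dimensional kernel inside one
row or one column** — the cell `(12, 4, 0)`.  So `sdc(per_4) ≥ 26` ⟺ «no size-`25` symmetric
pencil with Lagrangian one-row kernel» (val-width-5676-p2 g4's NC1 question).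

Honest framing: rung currency only; the tree's window stays `25 ≤ sdc(per₄) ≤ 29`; the crux
`SdcSuperquadratic` (`sdc(per_n) ≥ n^{2+ε}`) and `VP ≠ VNP` are untouched.  No definitions, no
named facts. [folklore]
-/

noncomputable section

-- single-conjunct layout: Sub = Summit, duplicated namespace component intended
set_option linter.dupNamespace false

namespace Summit.ValiantsHypothesis.ValiantsHypothesis.Theorems.SymPencilPerFourSixDimNoJointFamily

open Matrix MvPolynomial Finset Module
open Literature.Computability.AlgebraicComplexity
open Literature.Computability.AlgebraicComplexity.AlperBogartVelasco
open Summit.ValiantsHypothesis.ValiantsHypothesis.Theorems.SymPencilPerFourHessianMinors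
open Summit.ValiantsHypothesis.ValiantsHypothesis.Theorems.SymPencilPerFourHessianRowControl
open Summit.ValiantsHypothesis.ValiantsHypothesis.Theorems.SymPencilPerFourHessianColControl
open Summit.ValiantsHypothesis.ValiantsHypothesis.Theorems.SymPencilPerFourLowRankSeven
open Summit.ValiantsHypothesis.ValiantsHypothesis.Theorems.SymPencilPerFourTwoRowsRadical
open Summit.ValiantsHypothesis.ValiantsHypothesis.Theorems.SymPencilPerFourCoordinateRadical
open Summit.ValiantsHypothesis.ValiantsHypothesis.Theorems.SymPencilBoxFourEquality
open Summit.ValiantsHypothesis.ValiantsHypothesis.Theorems.SymPencilPerFourSixDimDetecting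
open Summit.ValiantsHypothesis.ValiantsHypothesis.Theorems.SymPencilPerFourSixDimCross
open Summit.ValiantsHypothesis.ValiantsHypothesis.Theorems.SymPencilPerFourSixDimPropPair
open Summit.ValiantsHypothesis.ValiantsHypothesis.Theorems.SymPencilPerFourSixDimZeroCellSix
open Summit.ValiantsHypothesis.ValiantsHypothesis.Theorems.SymPencilPerFourToricFive
open Summit.ValiantsHypothesis.ValiantsHypothesis.Theorems.SymPencilSdcPerFourTwentySixReduction
open Summit.ValiantsHypothesis.ValiantsHypothesis.Theorems.SymPencilSdcPerFourInnerRankH88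

variable {K : Type*} [Field K]

/-- **Case B3 is impossible at dimension `6`** (two rows: `SymPencilPerFourSixDimDetecting`;
cross: `SymPencilPerFourSixDimCross`). [folklore] -/
theorem false_of_zero_cell_six [CharZero K] {ι ι' : Type*} [Fintype ι] [Fintype ι']
    (hι : Fintype.card ι < 6) (hι' : Fintype.card ι' < 6) (W : Submodule K (Fin 4 × Fin 4 → K))
    (hW3 : ∀ x ∈ W, ∀ (r c : Fin 3 → Fin 4), Function.Injective r → Function.Injective c →
      ((Matrix.of fun i j => x (i, j)).submatrix r c).permanent = 0)
    (hW1 : ∀ u : Fin 4 × Fin 4 → K, ∃ (c : ι → K) (Λ : ι → ((Fin 4 × Fin 4 → K) →ₗ[K] K)),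
      ∀ y ∈ W, ∃ e₀ e₁ : K, ∀ s : K,
        eval (u + s • y) (perPoly (Fin 4) K) = e₀ + s * e₁ + s ^ 2 * ∑ k, c k * (Λ k y) ^ 2)
    (hW2 : ∀ y ∈ W, ∃ (c : ι' → K) (Λ : ι' → ((Fin 4 × Fin 4 → K) →ₗ[K] K)),
      ∀ u : Fin 4 × Fin 4 → K, ∃ e₀ e₁ : K, ∀ s : K,
        eval (u + s • y) (perPoly (Fin 4) K) = e₀ + s * e₁ + s ^ 2 * ∑ k, c k * (Λ k u) ^ 2)
    (a m₁ : Fin 4) (hzero : ∀ x ∈ W, x (a, m₁) = 0)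
    (hreal : ∀ v : Fin 4 → K, v m₁ = 0 → ∃ z ∈ W, ∀ j, z (a, j) = v j)
    (h6 : finrank K W = 6) : False := by
  rcases rows_or_cross_of_zero_cell_six hι' W hW3 hW2 a m₁ hzero hreal h6 with
    ⟨b, hba, hrows⟩ | ⟨c₀, hX⟩
  · refine false_of_detecting_rows_six hι hι' W hW3 h6 hba.symm (fun x hx ha hb => ?_) hW1 hW2
    funext p
    obtain ⟨i, j⟩ := p
    by_cases hia : i = a
    · rw [hia]; exact ha j
    by_cases hib : i = b
    · rw [hib]; exact hb j
    exact hrows x hx i j hia hib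
  · exact false_of_le_cross_six_of_sum_sq_swap hι' W hX h6 hW2

/-- **Rows have rank `≤ 2` at dimension `6`** (p2's dispatcher `finrank_map_row_le_two` with
the `6`-dimensional versions of Cases B2, B3). [folklore] -/
theorem finrank_map_row_le_two_six [CharZero K] {ι ι' : Type*} [Fintype ι] [Fintype ι']
    (hι : Fintype.card ι < 6) (hι' : Fintype.card ι' < 6) (W : Submodule K (Fin 4 × Fin 4 → K))
    (hW3 : ∀ x ∈ W, ∀ (r c : Fin 3 → Fin 4), Function.Injective r → Function.Injective c →
      ((Matrix.of fun i j => x (i, j)).submatrix r c).permanent = 0)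
    (hW1 : ∀ u : Fin 4 × Fin 4 → K, ∃ (c : ι → K) (Λ : ι → ((Fin 4 × Fin 4 → K) →ₗ[K] K)),
      ∀ y ∈ W, ∃ e₀ e₁ : K, ∀ s : K,
        eval (u + s • y) (perPoly (Fin 4) K) = e₀ + s * e₁ + s ^ 2 * ∑ k, c k * (Λ k y) ^ 2)
    (hW : ∀ y ∈ W, ∃ (c : ι' → K) (Λ : ι' → ((Fin 4 × Fin 4 → K) →ₗ[K] K)),
      ∀ u : Fin 4 × Fin 4 → K, ∃ e₀ e₁ : K, ∀ s : K,
        eval (u + s • y) (perPoly (Fin 4) K) = e₀ + s * e₁ + s ^ 2 * ∑ k, c k * (Λ k u) ^ 2)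
    (h6 : finrank K W = 6) (a : Fin 4) :
    finrank K (W.map (LinearMap.funLeft K K fun j : Fin 4 => (a, j))) ≤ 2 := by
  classical
  set ρ : (Fin 4 × Fin 4 → K) →ₗ[K] (Fin 4 → K) := LinearMap.funLeft K K fun j : Fin 4 => (a, j)
    with hρdef
  have hρ : ∀ x j, ρ x j = x (a, j) := fun _ _ => rfl
  by_contra hgt
  push Not at hgt
  have hle4 : finrank K (W.map ρ) ≤ 4 := by
    have := Submodule.finrank_le (W.map ρ)
    rwa [Module.finrank_fintype_fun_eq_card, Fintype.card_fin] at this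
  by_cases h4 : finrank K (W.map ρ) = 4
  · have htop : W.map ρ = ⊤ := Submodule.eq_top_of_finrank_eq (by
      rw [h4, Module.finrank_fintype_fun_eq_card, Fintype.card_fin])
    have honto : ∀ v : Fin 4 → K, ∃ z ∈ W, ∀ j, z (a, j) = v j := fun v => by
      have hv : v ∈ W.map ρ := by rw [htop]; exact Submodule.mem_top
      obtain ⟨z, hz, hzv⟩ := hv
      exact ⟨z, hz, fun j => by have := congr_fun hzv j; rwa [hρ] at this⟩
    have := finrank_le_four_of_row_onto hι' W hW a honto
    omega
  have h3 : finrank K (W.map ρ) = 3 := by omega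
  have hlt : W.map ρ < ⊤ := by
    refine lt_of_le_of_ne le_top fun h => h4 ?_
    rw [h, finrank_top, Module.finrank_fintype_fun_eq_card, Fintype.card_fin]
  obtain ⟨x₀, hx₀⟩ : ∃ x₀ : Fin 4 → K, x₀ ∉ W.map ρ := by
    by_contra h
    push Not at h
    exact (lt_top_iff_ne_top.1 hlt) (eq_top_iff.2 fun x _ => h x)
  obtain ⟨φ, hφ0, hφW⟩ := Submodule.exists_dual_map_eq_bot_of_notMem hx₀ inferInstance
  rw [← LinearMap.le_ker_iff_map] at hφW
  have hker3 : finrank K (LinearMap.ker φ) = 3 := by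
    have hφne : φ ≠ 0 := fun h => hφ0 (by rw [h, LinearMap.zero_apply])
    have h1 : finrank K (LinearMap.range φ) = 1 := by
      have hle : finrank K (LinearMap.range φ) ≤ 1 := by
        have := Submodule.finrank_le (LinearMap.range φ)
        rwa [Module.finrank_self] at this
      have hpos : 0 < finrank K (LinearMap.range φ) := by
        rw [Module.finrank_pos_iff_exists_ne_zero]
        exact ⟨⟨φ x₀, x₀, rfl⟩, fun h => hφ0 (Subtype.ext_iff.1 h)⟩
      omega
    have h := LinearMap.finrank_range_add_finrank_ker φ
    rw [Module.finrank_fintype_fun_eq_card, Fintype.card_fin] at h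
    omega
  have heq : W.map ρ = LinearMap.ker φ := Submodule.eq_of_le_of_finrank_le hφW (by omega)
  have hreal : ∀ v : Fin 4 → K, φ v = 0 → ∃ z ∈ W, ∀ j, z (a, j) = v j := by
    intro v hv
    have : v ∈ W.map ρ := by rw [heq, LinearMap.mem_ker]; exact hv
    obtain ⟨z, hz, hzv⟩ := this
    exact ⟨z, hz, fun j => by have := congr_fun hzv j; rwa [hρ] at this⟩
  set κ : Fin 4 → K := fun j => φ (Pi.single j 1) with hκ
  have hφv : ∀ v : Fin 4 → K, φ v = ∑ j, κ j * v j := by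
    intro v
    conv_lhs => rw [show v = ∑ j, v j • (Pi.single j (1 : K) : Fin 4 → K) from by
      ext i; simp [Finset.sum_apply, Pi.single_apply]]
    rw [map_sum]
    exact Finset.sum_congr rfl fun j _ => by rw [map_smul, smul_eq_mul, mul_comm]
  have hrel : ∀ x ∈ W, ∑ j, κ j * x (a, j) = 0 := by
    intro x hx
    have : ρ x ∈ W.map ρ := ⟨x, hx, rfl⟩
    rw [heq, LinearMap.mem_ker, hφv] at this
    exact this
  obtain ⟨m₁, hm₁⟩ : ∃ m₁, κ m₁ ≠ 0 := by
    by_contra h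
    push Not at h
    apply hφ0
    rw [hφv]
    exact Finset.sum_eq_zero fun j _ => by rw [h j, zero_mul]
  by_cases hB3 : ∀ j, j ≠ m₁ → κ j = 0
  · -- Case B3
    have hzero : ∀ x ∈ W, x (a, m₁) = 0 := by
      intro x hx
      have h := hrel x hx
      rw [Finset.sum_eq_single m₁ (fun j _ hj => by rw [hB3 j hj, zero_mul])
        (fun h => absurd (Finset.mem_univ _) h)] at h
      exact (mul_eq_zero.1 h).resolve_left hm₁
    have hreal' : ∀ v : Fin 4 → K, v m₁ = 0 → ∃ z ∈ W, ∀ j, z (a, j) = v j := by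
      intro v hv
      apply hreal
      rw [hφv, Finset.sum_eq_single m₁ (fun j _ hj => by rw [hB3 j hj, zero_mul])
        (fun h => absurd (Finset.mem_univ _) h), hv, mul_zero]
    exact false_of_zero_cell_six hι hι' W hW3 hW1 hW a m₁ hzero hreal' h6
  push Not at hB3
  obtain ⟨m₂, hm₂₁, hm₂⟩ := hB3
  by_cases hB2 : ∀ j, j ≠ m₁ → j ≠ m₂ → κ j = 0
  · -- Case B2
    set μ : K := -(κ m₂ / κ m₁) with hμdef
    have hμ : μ ≠ 0 := by
      rw [hμdef, neg_ne_zero]; exact div_ne_zero hm₂ hm₁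
    have hsum2 : ∀ v : Fin 4 → K, ∑ j, κ j * v j = κ m₁ * v m₁ + κ m₂ * v m₂ := by
      intro v
      rw [← Finset.sum_subset (Finset.subset_univ {m₁, m₂})
        (fun j _ hj => by
          rw [Finset.mem_insert, Finset.mem_singleton, not_or] at hj
          rw [hB2 j hj.1 hj.2, zero_mul]),
        Finset.sum_pair (Ne.symm hm₂₁)]
    have hprop : ∀ x ∈ W, x (a, m₁) = μ * x (a, m₂) := by
      intro x hx
      have h := hrel x hx
      rw [hsum2] at h
      rw [hμdef]
      field_simp
      linear_combination h
    have hreal' : ∀ v : Fin 4 → K, v m₁ = μ * v m₂ → ∃ z ∈ W, ∀ j, z (a, j) = v j := by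
      intro v hv
      apply hreal
      rw [hφv, hsum2, hv, hμdef]
      field_simp
      ring
    have := finrank_le_five_of_prop_pair hι' W hW a m₁ m₂ hm₂₁.symm μ hμ hprop hreal'
    omega
  · -- Case B1
    push Not at hB2
    obtain ⟨m₃, hm₃₁, hm₃₂, hm₃⟩ := hB2
    have pick : ∀ m c a₁ a₂ a₃ : Fin 4, a₁ ≠ a₂ → a₁ ≠ a₃ → a₂ ≠ a₃ →
        (a₁ ≠ m ∧ a₁ ≠ c) ∨ (a₂ ≠ m ∧ a₂ ≠ c) ∨ (a₃ ≠ m ∧ a₃ ≠ c) := by decide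
    have hgen : ∀ m c : Fin 4, m ≠ c → ∃ z ∈ W, z (a, m) = 1 ∧ z (a, c) = 0 := by
      intro m c hmc
      obtain ⟨p, hpm, hpc, hp⟩ : ∃ p, p ≠ m ∧ p ≠ c ∧ κ p ≠ 0 := by
        rcases pick m c m₁ m₂ m₃ hm₂₁.symm hm₃₁.symm hm₃₂.symm with h | h | h
        · exact ⟨m₁, h.1, h.2, hm₁⟩
        · exact ⟨m₂, h.1, h.2, hm₂⟩
        · exact ⟨m₃, h.1, h.2, hm₃⟩
      set v : Fin 4 → K := Pi.single m 1 - (κ m / κ p) • Pi.single p 1 with hv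
      have hφv0 : φ v = 0 := by
        rw [hv, map_sub, map_smul, smul_eq_mul]
        change κ m - κ m / κ p * κ p = 0
        field_simp
        ring
      obtain ⟨z, hz, hzv⟩ := hreal v hφv0
      refine ⟨z, hz, ?_, ?_⟩
      · rw [hzv, hv, Pi.sub_apply, Pi.smul_apply, Pi.single_eq_same, Pi.single_eq_of_ne hpm.symm,
          smul_zero, sub_zero]
      · rw [hzv, hv, Pi.sub_apply, Pi.smul_apply, Pi.single_eq_of_ne hmc.symm,
          Pi.single_eq_of_ne hpc.symm, smul_zero, sub_zero]
    have := finrank_le_four_of_row_generic hι' W hW a hgen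
    omega

/-- **No `6`-dimensional singular subspace with per-base-point and per-direction families of
`< 6` squares** (rows and columns of rank `≤ 2` by `finrank_map_row_le_two_six` and transposition,
then the toric bound `finrank_le_five_of_ranks_le_two`). [folklore] -/
theorem false_of_families_six [CharZero K] {ι ι' : Type*} [Fintype ι] [Fintype ι']
    (hι : Fintype.card ι < 6) (hι' : Fintype.card ι' < 6) (W : Submodule K (Fin 4 × Fin 4 → K))
    (hW3 : ∀ x ∈ W, ∀ (r c : Fin 3 → Fin 4), Function.Injective r → Function.Injective c →
      ((Matrix.of fun i j => x (i, j)).submatrix r c).permanent = 0)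
    (hW1 : ∀ u : Fin 4 × Fin 4 → K, ∃ (c : ι → K) (Λ : ι → ((Fin 4 × Fin 4 → K) →ₗ[K] K)),
      ∀ y ∈ W, ∃ e₀ e₁ : K, ∀ s : K,
        eval (u + s • y) (perPoly (Fin 4) K) = e₀ + s * e₁ + s ^ 2 * ∑ k, c k * (Λ k y) ^ 2)
    (hW2 : ∀ y ∈ W, ∃ (c : ι' → K) (Λ : ι' → ((Fin 4 × Fin 4 → K) →ₗ[K] K)),
      ∀ u : Fin 4 × Fin 4 → K, ∃ e₀ e₁ : K, ∀ s : K,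
        eval (u + s • y) (perPoly (Fin 4) K) = e₀ + s * e₁ + s ^ 2 * ∑ k, c k * (Λ k u) ^ 2)
    (h6 : finrank K W = 6) : False := by
  have hrow := finrank_map_row_le_two_six hι hι' W hW3 hW1 hW2 h6
  -- columns: transpose
  set τ := LinearEquiv.funCongrLeft K K (Equiv.prodComm (Fin 4) (Fin 4)) with hτ
  have hW1' := sqFamily_map W τ eval_perPoly_transpose hW1
  have hW2' := sqFamilySwap_map W τ eval_perPoly_transpose hW2
  have hW3' := subperm_vanish_transpose W hW3
  have h6' : finrank K (W.map τ.toLinearMap) = 6 := by rw [LinearEquiv.finrank_map_eq, h6]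
  have hcol : ∀ j : Fin 4, finrank K (W.map (LinearMap.funLeft K K fun i : Fin 4 => (i, j))) ≤ 2 := by
    intro j
    have h := finrank_map_row_le_two_six hι hι' (W.map τ.toLinearMap) hW3' hW1' hW2' h6' j
    have hcomp : (LinearMap.funLeft K K fun j' : Fin 4 => (j, j')) ∘ₗ τ.toLinearMap =
        LinearMap.funLeft K K fun i : Fin 4 => (i, j) := by
      apply LinearMap.ext; intro x; funext i; rfl
    rwa [← Submodule.map_comp, hcomp] at h
  have := finrank_le_five_of_ranks_le_two W hW3 hrow hcol
  omega

/-- **`H106`, unconditionally: no `6`-dimensional `V ⊆ Sing Z(per_4)` carries a joint (bilinear)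
family of `< 6` squares.** [folklore] -/
theorem noJointFamily_six [CharZero K] {d : ℕ} (hd : d < 6) (V : Submodule K (Fin 4 × Fin 4 → K))
    (hV3 : ∀ x ∈ V, ∀ (r c : Fin 3 → Fin 4), Function.Injective r → Function.Injective c →
      ((Matrix.of fun i j => x (i, j)).submatrix r c).permanent = 0)
    (h6 : finrank K V = 6) (c : Fin d → K)
    (β : Fin d → ((Fin 4 × Fin 4 → K) →ₗ[K] (Fin 4 × Fin 4 → K) →ₗ[K] K)) :
    ¬ (∀ u : Fin 4 × Fin 4 → K, ∀ y ∈ V, ∃ e₀ e₁ : K, ∀ s : K,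
        eval (u + s • y) (perPoly (Fin 4) K) = e₀ + s * e₁ + s ^ 2 * ∑ k, c k * (β k u y) ^ 2) := by
  intro hjoint
  have hdF : Fintype.card (Fin d) < 6 := by rwa [Fintype.card_fin]
  have hW1 : ∀ u : Fin 4 × Fin 4 → K, ∃ (c' : Fin d → K) (Λ : Fin d → ((Fin 4 × Fin 4 → K) →ₗ[K] K)),
      ∀ y ∈ V, ∃ e₀ e₁ : K, ∀ s : K,
        eval (u + s • y) (perPoly (Fin 4) K) = e₀ + s * e₁ + s ^ 2 * ∑ k, c' k * (Λ k y) ^ 2 :=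
    fun u => ⟨c, fun k => β k u, fun y hy => hjoint u y hy⟩
  have hW2 : ∀ y ∈ V, ∃ (c' : Fin d → K) (Λ : Fin d → ((Fin 4 × Fin 4 → K) →ₗ[K] K)),
      ∀ u : Fin 4 × Fin 4 → K, ∃ e₀ e₁ : K, ∀ s : K,
        eval (u + s • y) (perPoly (Fin 4) K) = e₀ + s * e₁ + s ^ 2 * ∑ k, c' k * (Λ k u) ^ 2 :=
    fun y hy => ⟨c, fun k => (β k).flip y, fun u => by
      obtain ⟨e₀, e₁, he⟩ := hjoint u y hy
      exact ⟨e₀, e₁, fun s => by simpa only [LinearMap.flip_apply] using he s⟩⟩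
  exact false_of_families_six hdF hdF V hV3 hW1 hW2 h6

/-- **Size `≤ 25` forces size `25` with a Lagrangian one-row (one-column) kernel —
UNCONDITIONALLY.**  Both cell hypotheses of
`SymPencilSdcPerFourTwentySixReduction.eq_twentyFive_and_oneRowKernel_of_le_twentyFive` are
discharged: `H88` by val-width-5674-p2 g2's `not_joint_eight_squares`, `H106` by
`noJointFamily_six`. [folklore] -/
theorem eq_twentyFive_and_oneRowKernel (K : Type*) [Field K] [CharZero K]
    {m : ℕ} (hm : m ≤ 25) {A : Matrix (Fin m) (Fin m) (MvPolynomial (Fin 4 × Fin 4) K)}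
    (hS : A.IsSymm) (hA : IsAffineDetRepr (perPoly (Fin 4) K) A) :
    m = 25 ∧
    ∃ (i₀ : Fin m) (D : Matrix {i // i ≠ i₀} {i // i ≠ i₀} K)
      (bL : (Fin 4 × Fin 4 → K) →ₗ[K] ({i // i ≠ i₀} → K))
      (CL : (Fin 4 × Fin 4 → K) →ₗ[K] Matrix {i // i ≠ i₀} {i // i ≠ i₀} K) (κ : K),
      IsUnit D.det ∧ Dᵀ = D ∧ (∀ z, (CL z)ᵀ = CL z) ∧ κ ≠ 0 ∧
      (∀ z, bL z ⬝ᵥ D⁻¹ *ᵥ bL z = 0) ∧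
      (∀ z, bL z ⬝ᵥ (D⁻¹ * CL z * D⁻¹) *ᵥ bL z = 0) ∧
      (∀ z, D.det * (bL z ⬝ᵥ (D⁻¹ * CL z * D⁻¹ * CL z * D⁻¹) *ᵥ bL z) =
        -(κ * eval z (perPoly (Fin 4) K))) ∧
      2 * finrank K (LinearMap.range bL) = 24 ∧ finrank K (LinearMap.ker bL) = 4 ∧
      ((∃ l : Fin 4, ∀ x ∈ LinearMap.ker bL, ∀ i j : Fin 4, i ≠ l → x (i, j) = 0) ∨
       (∃ c : Fin 4, ∀ x ∈ LinearMap.ker bL, ∀ i j : Fin 4, j ≠ c → x (i, j) = 0)) :=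
  eq_twentyFive_and_oneRowKernel_of_le_twentyFive K (not_joint_eight_squares K)
    (fun V hV3 h6 c β => noJointFamily_six (by norm_num) V hV3 h6 c β) hm hS hA

end Summit.ValiantsHypothesis.ValiantsHypothesis.Theorems.SymPencilPerFourSixDimNoJointFamily

end
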